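import Summits.BirchSwinnertonDyer.BirchSwinnertonDyer.Theses.AdditiveKolyvaginRoad
import Summits.BirchSwinnertonDyer.BirchSwinnertonDyer.Theorems.AdditiveKolyvaginRoadManinFrameTransport
import Summits.BirchSwinnertonDyer.BirchSwinnertonDyer.Theorems.AdditiveKolyvaginRoadManinFrameFromDatum
import Summits.BirchSwinnertonDyer.BirchSwinnertonDyer.Theorems.AdditiveKolyvaginRoadManinFrameResidueProperRTameTwistFull
import HarnessLib

/-! # Line `tame-twist` — skeleton v1 for crux `ManinFrameResidueProperR` (stmt-BirchSwinnertonDyer-20709,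
route AdditiveKolyvaginRoad), seat bsd-wall-manin-p1 g3 for the AKR tenure desk (bsd-wall-add g8 ruling
2026-08-27T20:41:15Z (3): "CAP-NEUTRAL PLAN OF RECORD … a SECOND LINE `tame-twist` on crux 20709").

Two stubs, composition kernel-checked:
* S57 `stub_memberManinUnit_fiveSeven` — VERBATIM the registered S57 of line `birth` (b80c085558f79197):
  Manin's `p`-part for some minimal member at `p ∈ {5, 7}` (research; Edixhoven's facts and Kato's
  divisibility in Néron units (Kosters–Pannekoek: `p > 7`) say nothing here).
* F′ `stub_katoNeronTwistedSymbolSum : kato_neron_isIntegral_twistedSymbolSum_of_additive` — the ONE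
  published input of the tame-twist lever: Kato's zeta-element integrality in Néron units for ALL tame
  characters at an additive prime `p > 7` with `E[p]` irreducible (Kato 2004 (8.1.3)/Thm 9.7/6.6 +
  Kim–Nakamura Cor. 2.4 ⟸ Kosters–Pannekoek 2019 Thm 1); statement-only in the tree
  (`Literature/NumberTheory/EllipticCurves/KatoAdditiveTwistedValueNeronIntegrality.lean`, p563901) — an
  honest XL stub (a formalisation of a published theorem), never a grant.
* composition `ManinFrameResidueProperR_of`: `p < 11` → S57; `p ≥ 11` → the FULL tame-twist lever
  `…Theorems.ManinFrameResidueProperRTameTwist.exists_member_not_dvd_c_of_tameTwistL` (Theorems file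
  `…RTameTwistFull`, kernel-checked, NO hypothesis on `(N, a_ℓ)`: all odd tame characters modulo auxiliary
  primes `d′ ≡ d_γ (c_γ)`, Legendre conditions at the resonant primes `ℓ ≡ ±a_ℓ (p)`, `γ⁴ = γ₁γ₂`
  splitting, `Λ_f = range cuspSymbol`, lattice-optimal data) gives a member `W₀ ∼ W` with a conductor-level
  datum of Manin-unit `c`; then, exactly as line `birth`: prime-to-`p` transport
  (`ManinFrameTransport.exists_modularParametrizationData_not_dvd_of_partner`, Irr) and the Hoffstein–Luo odd
  Heegner frame (`ManinFrameFromDatum.exists_oddHeegnerFrame_of_exists_not_dvd`).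
Compared with `birth`: the research stub TDS (`stub_twistDegreeStep`, Manin's `p`-part on Edixhoven's
exceptional locus — open in print) is REPLACED by a published theorem; the three Edixhoven/Dokchitser
binders `e1 e2 dd` of the crux are not even used on the `p ≥ 11` branch. BSD is not proved by any of this;
the crux closes only when BOTH stubs are proved. -/

set_option autoImplicit false
set_option linter.dupNamespace false

noncomputable section

open scoped Classical


open WeierstrassCurve NumberField Literature.NumberTheory.EllipticCurves
  Literature.NumberTheory.EllipticCurves.ModularForms
  Literature.NumberTheory.EllipticCurves.Rank1Residual
  Literature.NumberTheory.DiophantineGeometry IsDedekindDomain Rat.HeightOneSpectrum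
  Summit.BirchSwinnertonDyer.Rank1Residual Summit.BirchSwinnertonDyer.Rank1Residual.Additive
  Summit.BirchSwinnertonDyer.BirchSwinnertonDyer.Theses.AdditiveKolyvaginRoad

namespace Summit.BirchSwinnertonDyer.BirchSwinnertonDyer.Cruxes.ManinFrameResidueProperR.TameTwist

/-- **Stub S57 — Manin's `p`-part for SOME minimal member, `p ∈ {5, 7}`** (research; VERBATIM the
registered S57 of line `birth`): on the residue at `p = 5, 7` (additive, `E[p]` irreducible, no `Iₙ*`
member, every parametrisation of every minimal member at level `N(W)` of degree divisible by `p`), some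
globally minimal `W₀ ∼ W` has a parametrisation datum at level `N(W)` with `p ∤ c(D₀)`.
[cite: EdixhovenManin1991, Thm. 3 and Prop. 7] [cite: AgasheRibetStein2006, Thm. 2.6]
[cite: CesnaviciusNeururerSaha2023, Thm. 1.2] -/
theorem stub_memberManinUnit_fiveSeven
    (hnf : Literature.NumberTheory.EllipticCurves.ModularForms.exists_isNewformOf)
    (W : WeierstrassCurve ℚ) [W.IsElliptic] [W.IsGloballyMinimal] (p : ℕ) [Fact p.Prime]
    [NeZero (W.conductorNorm ℤ)] (hp5 : 5 ≤ p) (hp11 : p < 11) (hadd : Addv W p) (hirr : Irr W p)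
    (hres : ((p < 11 ∨ ∃ (W' : WeierstrassCurve ℚ) (_ : W'.IsElliptic) (_ : W'.IsGloballyMinimal),
          IsIsogenous W W' ∧ TypeGOrd W' p ∧ padicValInt p W'.minimalDiscriminantInt ≤ 4) ∧
        (∃ (W' : WeierstrassCurve ℚ) (_ : W'.IsElliptic) (_ : W'.IsGloballyMinimal),
          IsIsogenous W W' ∧ ∀ (v : HeightOneSpectrum ℤ) (n : ℕ), natGenerator v = p →
            W'.kodairaSymbolAt v ≠ KodairaSymbol.Istar n)))
    (hall : (∀ (W' : WeierstrassCurve ℚ) [W'.IsElliptic] [W'.IsGloballyMinimal]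
          (D' : ModularParametrizationData W' (W.conductorNorm ℤ)),
          IsIsogenous W W' → p ∣ D'.modularDegree)) :
    ∃ (W₀ : WeierstrassCurve ℚ) (_ : W₀.IsElliptic) (_ : W₀.IsGloballyMinimal)
        (D₀ : ModularParametrizationData W₀ (W.conductorNorm ℤ)),
        IsIsogenous W W₀ ∧ ¬ (p : ℤ) ∣ D₀.c := by
  sorry

/-- **Stub F′ — Kato's zeta-element integrality in Néron units, all tame characters** (PUBLISHED; the
tree's statement-only Literature fact `kato_neron_isIntegral_twistedSymbolSum_of_additive`, p563901): for
`E/ℚ` globally minimal with newform `f`, additive at `p > 7` with `E[p]` irreducible, every primitive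
nontrivial tame Dirichlet character `χ` of prime-to-`pN` conductor with `p ∤ ord χ`, the Euler-modified
twisted modular-symbol sum `(∏_{ℓ ∥ N} (ℓ − a_ℓχ(ℓ))(ℓ − a_ℓχ̄(ℓ))) · Σ_a χ̄(a){∞, a/m}_f^±`, measured in the
Néron period `Ω^±(E)`, is `p`-integral up to a `p`-unit (Kato 2004 (8.1.3), Thm 9.7, Thm 6.6; Kim–Nakamura
Cor. 2.4; the image of `ρ_{E,p}` contains a conjugate of `SL₂(ℤ_p)` by Kosters–Pannekoek 2019 Thm 1 since
`p > 7` is additive with `E[p]` irreducible). An honest XL formalisation target (explicit reciprocity law),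
not research. [cite: Kato2004Asterisque, (8.1.3) (p. 180), Thm. 9.7 (p. 189), Thm. 6.6]
[cite: KimNakamura2020, Cor. 2.4] [cite: KostersPannekoek2019, Thm. 1] -/
theorem stub_katoNeronTwistedSymbolSum :
    Literature.NumberTheory.EllipticCurves.kato_neron_isIntegral_twistedSymbolSum_of_additive := by
  sorry

/-- **The composition (no sorry of its own; the two stubs are used BY NAME) ⟹ `ManinFrameResidueProperR`.**
`p < 11`: S57. `p ≥ 11`: the full tame-twist lever `exists_member_not_dvd_c_of_tameTwistL` fed with F′.
Then, as in line `birth`: transport to a datum of `W` with `p ∤ c`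
(`ManinFrameTransport.exists_modularParametrizationData_not_dvd_of_partner`, Irr) and the Hoffstein–Luo odd
Heegner frame (`ManinFrameFromDatum.exists_oddHeegnerFrame_of_exists_not_dvd`, conjuncts 6 and 7 of
`PublishedInputsAdditiveKoly`). -/
theorem ManinFrameResidueProperR_of :
    Summit.BirchSwinnertonDyer.BirchSwinnertonDyer.Theses.AdditiveKolyvaginRoad.ManinFrameResidueProperR := by
  intro _e1 _e2 _dd hPub W _ _ p hp _ hp5 hadd hirr hres hall hr
  have hnf : Literature.NumberTheory.EllipticCurves.ModularForms.exists_isNewformOf := hPub.2.2.2.2.2.1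
  -- a member with a Manin-unit datum, by prime range (S57 / the tame-twist lever through F′)
  have hmem : ∃ (W₀ : WeierstrassCurve ℚ) (_ : W₀.IsElliptic) (_ : W₀.IsGloballyMinimal)
      (D₀ : ModularParametrizationData W₀ (W.conductorNorm ℤ)),
      IsIsogenous W W₀ ∧ ¬ (p : ℤ) ∣ D₀.c := by
    rcases lt_or_ge p 11 with h11 | h11
    · exact stub_memberManinUnit_fiveSeven hnf W p hp5 h11 hadd hirr hres hall
    · exact Summit.BirchSwinnertonDyer.BirchSwinnertonDyer.Theorems.ManinFrameResidueProperRTameTwist.exists_member_not_dvd_c_of_tameTwistL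
        stub_katoNeronTwistedSymbolSum hnf W h11 hadd hirr
  obtain ⟨W₀, hE₀, hM₀, D₀, hiso, hc₀⟩ := hmem
  haveI := hE₀
  haveI := hM₀
  -- transport to a datum of `W` with `p ∤ c` (prime-to-`p` isogeny multiplier under Irr)
  obtain ⟨Dt, hc⟩ :=
    Summit.BirchSwinnertonDyer.BirchSwinnertonDyer.Theorems.ManinFrameTransport.exists_modularParametrizationData_not_dvd_of_partner
      W hp.out hirr hiso D₀ hc₀
  -- the Hoffstein–Luo odd Heegner frame
  have hp2 : p ≠ 2 := by omega
  exact Summit.BirchSwinnertonDyer.BirchSwinnertonDyer.Theorems.ManinFrameFromDatum.exists_oddHeegnerFrame_of_exists_not_dvd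
    hnf hPub.2.2.2.2.2.2.1 W p hr hp2 ⟨Dt, hc⟩

end Summit.BirchSwinnertonDyer.BirchSwinnertonDyer.Cruxes.ManinFrameResidueProperR.TameTwist

end
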